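import Literature.AlgebraicGeometry.HodgeTheory.TangentSheafSectionsDerivations
import Literature.AlgebraicGeometry.Deformation.FlatDeformationGlobalFunctions
import Literature.AlgebraicGeometry.Deformation.SmoothAffineDeformationsDualNumber
import HarnessLib

/-!
# Local retractions of a first-order deformation form a torsor under the tangent sheaf
# (the affine step of the Kodaira–Spencer class of `X' → Spec k[ε]`)

Layer `Literature/AlgebraicGeometry/Deformation` (cell hodgecm-mathlib, SOCKETS-F §4 (α) node E2-c/d, brick K2). Setting: `k` a
field, `X : Over (Spec k)`, `f : X' ⟶ Spec k[ε]`, `i : X ⟶ X'` its closed fibre (`IsPullback i X.hom f (Spec (k[ε] → k))`, the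
currency of `Deformation/SmallExtensionIdealSheafFlat`), `t = ε·1 ∈ Γ(X', ⊤)`. On an AFFINE open `V ⊆ X'` (`U = i⁻¹V`) a
**retraction** is a ring map `σ : Γ(U, 𝒪_X) → Γ(V, 𝒪_{X'})` with `i♯ ∘ σ = id` — a lift of `id_X` across the first-order
thickening `X ↪ X'`, i.e. a trivialisation of `X'|_V` (Hartshorne, *Deformation Theory*, proof of Thm. 5.3: «choose an
isomorphism `φ_i : U_i ×_k D ⥲ U'_i`»; SGA 3 III 5.1 in retraction form). Proved here, WITHOUT new definitions:
`existsUnique_retraction_eq_add` (the twist `σ ⊕ θ : a ↦ σ(a) + t·σ(θ(da))` by `θ ∈ Γ(U, 𝒯_{X/k})`, again a retraction: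
`app_eq_self_of_eq_add`, `map_constToPresheaf_eq_of_eq_add`); `eq_add_add_of_eq_add`, `eq_add_neg_of_eq_add`, `eq_add_zero`
(«composition of automorphisms corresponds to addition of derivations»); **`existsUnique_tangentSheaf_section_of_retractions`**
(`X'` FLAT: two retractions over an affine `V` with the same values on `k` differ by a UNIQUE `θ`, via `𝓘(V) = t·Γ ≅ Γ(U, 𝒪_X)`
and `Γ(U, 𝒯) = Der_k(Γ(U, 𝒪_X))`, `HodgeTheory/TangentSheafSectionsDerivations`); **`eq_add_restrictHom_of_eq_add`**
(compatibility with restriction to an affine `V' ⊆ V`); `exists_retraction_of_formallySmooth` (local existence when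
`Γ(U, 𝒪_X)` is formally smooth over `k`). These are the `existsUnique_act_eq` / `res_act` / cocycle inputs of the pseudotorsor
of local retractions (`Deformation/PseudotorsorObstructionClass`), whose class is the Kodaira–Spencer class of `X'` (sequel).

## References

* [Hartshorne2010] R. Hartshorne, *Deformation Theory*, GTM 257 (2010): Thm. 5.3 and proof, pp. 38–39; Lemma 4.5 (p. 28),
  Remark 10.1.1 (p. 80); Cor. 4.8 (p. 30); §6 (6.1), p. 46, and proof of Thm. 6.4, p. 50; §2 p. 9–10.
* [Hartshorne1977] R. Hartshorne, *Algebraic Geometry*, GTM 52 (1977): II.8 pp. 172, 180; III Ex. 9.13.2.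
-/

noncomputable section

-- `TopCat.Presheaf`/`TopCat.Sheaf` are not reducible (as in Mathlib's `AlgebraicGeometry/Modules`).
set_option backward.isDefEq.respectTransparency false

open CategoryTheory AlgebraicGeometry Opposite TopologicalSpace
open TrivSqZeroExt DualNumber

universe u

namespace Literature.AlgebraicGeometry.Deformation

open Literature.AlgebraicGeometry.HodgeTheory Literature.AlgebraicGeometry.Modules
  Literature.AlgebraicGeometry.Motives

/-! ### §0 The dual numbers as a principal small extension `k[ε] ↠ k` (inputs of `SmallExtensionIdealSheafFlat`) -/

section DualNumberPack

variable (k : Type u) [Field k]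

/-- `k[ε] → k` is surjective. [cite: Hartshorne2010, §2 p. 10 («`D = k[t]/t²`»)] -/
theorem dualNumber_fstHom_surjective : Function.Surjective (fstHom k k k).toRingHom :=
  fun x => ⟨inl x, fst_inl k x⟩

/-- `ker (k[ε] → k) = (ε)`. [cite: Hartshorne2010, §2 p. 10 («`D = k[t]/t²`»)] -/
theorem dualNumber_ker_fstHom_eq_span : RingHom.ker (fstHom k k k).toRingHom = Ideal.span {(ε : k[ε])} :=
  SmoothAffineDeformation.ker_fstHom_eq_span_eps k

/-- `ker (k[ε] → k)` is the maximal ideal of the local ring `k[ε]`. [cite: Hartshorne2010, §6 (6.1), p. 46] -/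
theorem dualNumber_ker_fstHom_eq_maximalIdeal :
    RingHom.ker (fstHom k k k).toRingHom = IsLocalRing.maximalIdeal k[ε] := by
  rw [dualNumber_ker_fstHom_eq_span, DualNumber.maximalIdeal_eq_span_singleton_eps]

/-- `ε · 𝔪 = 0` in `k[ε]`. [cite: Hartshorne2010, §6 (6.1), p. 46 («`𝔪_{C'} J = 0`»)] -/
theorem dualNumber_eps_mul_eq_zero_of_mem_maximalIdeal :
    ∀ m ∈ IsLocalRing.maximalIdeal k[ε], (ε : k[ε]) * m = 0 := by
  intro m hm
  rw [DualNumber.maximalIdeal_eq_span_singleton_eps, Ideal.mem_span_singleton'] at hm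
  obtain ⟨a, rfl⟩ := hm
  rw [mul_comm a, ← mul_assoc, eps_mul_eps, zero_mul]

/-- `ε ≠ 0`. [cite: Hartshorne2010, §2 p. 10 («`D = k[t]/t²`»)] -/
theorem dualNumber_eps_ne_zero : (ε : k[ε]) ≠ 0 := fun h => by
  have := congrArg TrivSqZeroExt.snd h
  rw [snd_eps, snd_zero] at this
  exact one_ne_zero this

end DualNumberPack

/-! ### §1 The parameter `t` and retractions over an affine open -/

section Retractions

variable {k : Type u} [Field k] {X : Over (Spec (CommRingCat.of k))} {X' : Scheme.{u}}
  (f : X' ⟶ Spec (.of k[ε])) {i : X.left ⟶ X'}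
  (Hi : IsPullback i X.hom f (Spec.map (CommRingCat.ofHom (fstHom k k k).toRingHom)))

/-- `(t|_V)² = 0` for the parameter `t = ε · 1 ∈ Γ(X', ⊤)`. [cite: Hartshorne2010, §2 p. 10 («`t² = 0`»)] -/
theorem sectionOn_param_mul_self (V : X'.Opens) :
    sectionOn (flatSmallExtensionParam f (ε : k[ε])) V * sectionOn (flatSmallExtensionParam f (ε : k[ε])) V = 0 :=
  sectionOn_mul_self _ (by rw [flatSmallExtensionParam_def, ← map_mul, eps_mul_eps, map_zero]) V

include Hi in
/-- The closed fibre `i : X ↪ X'` is a closed immersion. [cite: Hartshorne2010, §6 (6.1), p. 46] -/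
theorem isClosedImmersion_fibre_dualNumber : IsClosedImmersion i :=
  isClosedImmersion_of_isPullback_fibre f (fstHom k k k).toRingHom (dualNumber_fstHom_surjective k) Hi

include Hi in
/-- `i⁻¹V` is affine for `V` affine (`i` is affine). [cite: Hartshorne2010, §6 (6.1), p. 46] -/
theorem isAffineOpen_preimage_fibre_dualNumber (V : X'.affineOpens) : IsAffineOpen (i ⁻¹ᵁ V.1) := by
  haveI := isClosedImmersion_fibre_dualNumber f Hi
  exact V.2.preimage i

include Hi in
/-- `i♯(t|_V · b) = 0`. [cite: Hartshorne2010, §6 proof of Thm. 6.4, p. 50] -/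
theorem app_sectionOn_param_mul (V : X'.Opens) (b : Γ(X', V)) :
    i.app V (sectionOn (flatSmallExtensionParam f (ε : k[ε])) V * b) = 0 :=
  app_sectionOn_mul_eq_zero f (fstHom k k k).toRingHom (ε : k[ε]) (dualNumber_ker_fstHom_eq_span k) Hi V b

include Hi in
/-- `t|_V · b` depends only on `i♯ b` (`t · ker i♯ = 0`). [cite: Hartshorne2010, §6 proof of Thm. 6.4, p. 50] -/
theorem sectionOn_param_mul_eq_of_app_eq (V : X'.affineOpens) (b b' : Γ(X', V.1))
    (h : i.app V.1 b = i.app V.1 b') :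
    sectionOn (flatSmallExtensionParam f (ε : k[ε])) V.1 * b = sectionOn (flatSmallExtensionParam f (ε : k[ε])) V.1 * b' :=
  sectionOn_mul_eq_of_app_eq f (ε : k[ε]) (fstHom k k k).toRingHom (dualNumber_fstHom_surjective k)
    (dualNumber_ker_fstHom_eq_maximalIdeal k) (dualNumber_eps_mul_eq_zero_of_mem_maximalIdeal k) Hi V b b' h

include Hi in
/-- `ker i♯ = t|_V · Γ(V, 𝒪_{X'})` on an affine `V`. [cite: Hartshorne2010, §6 proof of Thm. 6.4, p. 50] -/
theorem exists_eq_sectionOn_param_mul (V : X'.affineOpens) (a : Γ(X', V.1)) (ha : i.app V.1 a = 0) :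
    ∃ b, a = sectionOn (flatSmallExtensionParam f (ε : k[ε])) V.1 * b :=
  exists_eq_sectionOn_mul_of_app_eq_zero f (fstHom k k k).toRingHom (dualNumber_fstHom_surjective k) (ε : k[ε])
    (dualNumber_ker_fstHom_eq_span k) Hi V a ha

include Hi in
/-- Flatness: `t|_V · b = 0 ⇒ i♯ b = 0` on an affine `V`. [cite: Hartshorne2010, §6 (6.1), p. 46 and §2 Prop. 2.2, p. 9] -/
theorem app_eq_zero_of_sectionOn_param_mul_eq_zero [Flat f] (V : X'.affineOpens) (b : Γ(X', V.1))
    (hb : sectionOn (flatSmallExtensionParam f (ε : k[ε])) V.1 * b = 0) : i.app V.1 b = 0 :=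
  app_eq_zero_of_sectionOn_mul_eq_zero_fibre f (ε : k[ε]) (fstHom k k k).toRingHom (dualNumber_fstHom_surjective k)
    (dualNumber_ker_fstHom_eq_maximalIdeal k) (dualNumber_eps_mul_eq_zero_of_mem_maximalIdeal k)
    (dualNumber_eps_ne_zero k) Hi V b hb

include Hi in
/-- `y ↦ t|_V · σ(y)` is injective for a retraction `σ` (flat `X'`). [cite: Hartshorne2010, §6 proof of Thm. 6.4, p. 50] -/
theorem eq_zero_of_sectionOn_param_mul_retraction_eq_zero [Flat f] (V : X'.affineOpens)
    (σ : Γ(X.left, i ⁻¹ᵁ V.1) →+* Γ(X', V.1)) (hσ : ∀ a, i.app V.1 (σ a) = a) (y : Γ(X.left, i ⁻¹ᵁ V.1))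
    (hy : sectionOn (flatSmallExtensionParam f (ε : k[ε])) V.1 * σ y = 0) : y = 0 := by
  rw [← hσ y]
  exact app_eq_zero_of_sectionOn_param_mul_eq_zero f Hi V (σ y) hy

/-! ### §2 Twisting a retraction by a section of the tangent sheaf: `σ ⊕ θ = σ + t · σ(θ ∘ d)` -/

/-- **The twist `σ ⊕ θ : a ↦ σ(a) + t · σ(θ(da))` is a ring map** (and the unique one with these values; multiplicativity
by `t² = 0` and the Leibniz rule). [cite: Hartshorne2010, Lemma 4.5 / Remark 10.1.1 (p. 28, p. 80: `x ↦ x + tD(x)`) and Thm. 5.3 (proof), p. 38] -/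
theorem existsUnique_retraction_eq_add (V : X'.affineOpens) (σ : Γ(X.left, i ⁻¹ᵁ V.1) →+* Γ(X', V.1))
    (θ : (cotangentSheaf X).over (i ⁻¹ᵁ V.1) ⟶ (unitModule X.left).over (i ⁻¹ᵁ V.1)) :
    ∃! σ' : Γ(X.left, i ⁻¹ᵁ V.1) →+* Γ(X', V.1),
      ∀ a, σ' a = σ a + sectionOn (flatSmallExtensionParam f (ε : k[ε])) V.1 *
        σ (appLE θ (𝟙 _) (dSection X (i ⁻¹ᵁ V.1) a) : Γ(X.left, i ⁻¹ᵁ V.1)) := by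
  set t := sectionOn (flatSmallExtensionParam f (ε : k[ε])) V.1 with ht
  have t2 : t * t = 0 := sectionOn_param_mul_self f V.1
  let D : Γ(X.left, i ⁻¹ᵁ V.1) → Γ(X.left, i ⁻¹ᵁ V.1) := fun a =>
    (appLE θ (𝟙 _) (dSection X (i ⁻¹ᵁ V.1) a) : Γ(X.left, i ⁻¹ᵁ V.1))
  have hD1 : D 1 = 0 := appLE_dSection_one θ
  have hDadd : ∀ a b, D (a + b) = D a + D b := appLE_dSection_add θ
  have hDmul : ∀ a b, D (a * b) = a * D b + b * D a := appLE_dSection_mul' θ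
  refine ⟨{ toFun := fun a => σ a + t * σ (D a)
            map_one' := by rw [hD1, map_zero, mul_zero, add_zero, map_one]
            map_mul' := fun a b => by
              rw [hDmul, map_add, map_mul, map_mul, map_mul]
              linear_combination (-(σ (D a) * σ (D b))) * t2
            map_zero' := by
              have hD0 : D 0 = 0 := by
                change appLE θ _ (dSection X _ 0) = 0
                rw [dSection_zero, appLE_zero_right]
              rw [map_zero, zero_add, hD0, map_zero, mul_zero]
            map_add' := fun a b => by
              rw [hDadd, map_add, map_add]
              ring }, fun a => rfl, fun σ₁ h₁ => RingHom.ext fun a => h₁ a⟩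

include Hi in
/-- `σ ⊕ θ` is again a retraction: `i♯ ∘ (σ ⊕ θ) = id`. [cite: Hartshorne2010, Thm. 5.3 (proof), p. 38] -/
theorem app_eq_self_of_eq_add (V : X'.affineOpens) {σ σ' : Γ(X.left, i ⁻¹ᵁ V.1) →+* Γ(X', V.1)}
    (hσ : ∀ a, i.app V.1 (σ a) = a)
    {θ : (cotangentSheaf X).over (i ⁻¹ᵁ V.1) ⟶ (unitModule X.left).over (i ⁻¹ᵁ V.1)}
    (hσ' : ∀ a, σ' a = σ a + sectionOn (flatSmallExtensionParam f (ε : k[ε])) V.1 *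
      σ (appLE θ (𝟙 _) (dSection X (i ⁻¹ᵁ V.1) a) : Γ(X.left, i ⁻¹ᵁ V.1))) (a : Γ(X.left, i ⁻¹ᵁ V.1)) :
    i.app V.1 (σ' a) = a := by
  rw [hσ', map_add, hσ, app_sectionOn_param_mul f Hi, add_zero]

/-- `σ ⊕ θ` has the same values on the constants `k` as `σ` (`d` kills the constants).
[cite: Hartshorne2010, Thm. 5.3 (proof), p. 38] -/
theorem map_constToPresheaf_eq_of_eq_add (V : X'.affineOpens) {σ σ' : Γ(X.left, i ⁻¹ᵁ V.1) →+* Γ(X', V.1)}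
    {θ : (cotangentSheaf X).over (i ⁻¹ᵁ V.1) ⟶ (unitModule X.left).over (i ⁻¹ᵁ V.1)}
    (hσ' : ∀ a, σ' a = σ a + sectionOn (flatSmallExtensionParam f (ε : k[ε])) V.1 *
      σ (appLE θ (𝟙 _) (dSection X (i ⁻¹ᵁ V.1) a) : Γ(X.left, i ⁻¹ᵁ V.1))) (s : k) :
    σ' ((constToPresheaf X).app (op (i ⁻¹ᵁ V.1)) s) = σ ((constToPresheaf X).app (op (i ⁻¹ᵁ V.1)) s) := by
  rw [hσ', appLE_dSection_constToPresheaf_app]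
  change _ + _ * σ 0 = _
  rw [map_zero, mul_zero, add_zero]

include Hi in
/-- **Additivity** («composition of automorphisms corresponds to addition of derivations»):
`(σ ⊕ θ) ⊕ θ' = σ ⊕ (θ + θ')`. [cite: Hartshorne2010, Thm. 5.3 (proof), p. 38] -/
theorem eq_add_add_of_eq_add (V : X'.affineOpens) {σ₁ σ₂ σ₃ : Γ(X.left, i ⁻¹ᵁ V.1) →+* Γ(X', V.1)}
    (hσ₁ : ∀ a, i.app V.1 (σ₁ a) = a)
    {θ θ' : (cotangentSheaf X).over (i ⁻¹ᵁ V.1) ⟶ (unitModule X.left).over (i ⁻¹ᵁ V.1)}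
    (h₁₂ : ∀ a, σ₂ a = σ₁ a + sectionOn (flatSmallExtensionParam f (ε : k[ε])) V.1 *
      σ₁ (appLE θ (𝟙 _) (dSection X (i ⁻¹ᵁ V.1) a) : Γ(X.left, i ⁻¹ᵁ V.1)))
    (h₂₃ : ∀ a, σ₃ a = σ₂ a + sectionOn (flatSmallExtensionParam f (ε : k[ε])) V.1 *
      σ₂ (appLE θ' (𝟙 _) (dSection X (i ⁻¹ᵁ V.1) a) : Γ(X.left, i ⁻¹ᵁ V.1))) (a : Γ(X.left, i ⁻¹ᵁ V.1)) :
    σ₃ a = σ₁ a + sectionOn (flatSmallExtensionParam f (ε : k[ε])) V.1 *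
      σ₁ (appLE (θ + θ') (𝟙 _) (dSection X (i ⁻¹ᵁ V.1) a) : Γ(X.left, i ⁻¹ᵁ V.1)) := by
  have hσ₂ : ∀ a, i.app V.1 (σ₂ a) = a := app_eq_self_of_eq_add f Hi V hσ₁ h₁₂
  have hlift : ∀ y, sectionOn (flatSmallExtensionParam f (ε : k[ε])) V.1 * σ₂ y =
      sectionOn (flatSmallExtensionParam f (ε : k[ε])) V.1 * σ₁ y := fun y =>
    sectionOn_param_mul_eq_of_app_eq f Hi V _ _ (by rw [hσ₁, hσ₂])
  rw [h₂₃, hlift, h₁₂, appLE_add, map_add, mul_add, add_assoc]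

/-- `σ = σ ⊕ 0`. [cite: Hartshorne2010, Thm. 5.3 (proof), p. 38] -/
theorem eq_add_zero (V : X'.affineOpens) (σ : Γ(X.left, i ⁻¹ᵁ V.1) →+* Γ(X', V.1))
    (a : Γ(X.left, i ⁻¹ᵁ V.1)) :
    σ a = σ a + sectionOn (flatSmallExtensionParam f (ε : k[ε])) V.1 *
      σ (appLE (0 : (cotangentSheaf X).over (i ⁻¹ᵁ V.1) ⟶ (unitModule X.left).over (i ⁻¹ᵁ V.1)) (𝟙 _)
        (dSection X (i ⁻¹ᵁ V.1) a) : Γ(X.left, i ⁻¹ᵁ V.1)) := by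
  rw [appLE_zero]
  change _ = _ + _ * σ 0
  rw [map_zero, mul_zero, add_zero]

include Hi in
/-- **Symmetry**: `σ' = σ ⊕ θ ⇒ σ = σ' ⊕ (−θ)`. [cite: Hartshorne2010, Thm. 5.3 (proof), p. 38 («`θ'_{ij} = θ_ij + α_i − α_j`»)] -/
theorem eq_add_neg_of_eq_add (V : X'.affineOpens) {σ σ' : Γ(X.left, i ⁻¹ᵁ V.1) →+* Γ(X', V.1)}
    (hσ : ∀ a, i.app V.1 (σ a) = a)
    {θ : (cotangentSheaf X).over (i ⁻¹ᵁ V.1) ⟶ (unitModule X.left).over (i ⁻¹ᵁ V.1)}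
    (hσ' : ∀ a, σ' a = σ a + sectionOn (flatSmallExtensionParam f (ε : k[ε])) V.1 *
      σ (appLE θ (𝟙 _) (dSection X (i ⁻¹ᵁ V.1) a) : Γ(X.left, i ⁻¹ᵁ V.1))) (a : Γ(X.left, i ⁻¹ᵁ V.1)) :
    σ a = σ' a + sectionOn (flatSmallExtensionParam f (ε : k[ε])) V.1 *
      σ' (appLE (-θ) (𝟙 _) (dSection X (i ⁻¹ᵁ V.1) a) : Γ(X.left, i ⁻¹ᵁ V.1)) := by
  have hσ'ret : ∀ a, i.app V.1 (σ' a) = a := app_eq_self_of_eq_add f Hi V hσ hσ'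
  have hlift : ∀ y, sectionOn (flatSmallExtensionParam f (ε : k[ε])) V.1 * σ' y =
      sectionOn (flatSmallExtensionParam f (ε : k[ε])) V.1 * σ y := fun y =>
    sectionOn_param_mul_eq_of_app_eq f Hi V _ _ (by rw [hσ, hσ'ret])
  have hz : appLE θ (𝟙 _) (dSection X (i ⁻¹ᵁ V.1) a) + appLE (-θ) (𝟙 _) (dSection X (i ⁻¹ᵁ V.1) a) = 0 := by
    rw [← appLE_add, add_neg_cancel, appLE_zero]
  have hz' := congrArg (fun y : Γ(X.left, i ⁻¹ᵁ V.1) => sectionOn (flatSmallExtensionParam f (ε : k[ε])) V.1 * σ y) hz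
  simp only [map_add, mul_add, map_zero, mul_zero] at hz'
  rw [hlift, hσ' a, add_assoc, hz', add_zero]


/-! ### §3 Flat case: any two retractions differ by a unique section of the tangent sheaf -/

include Hi in
/-- **Retractions over an affine open form a torsor under `Γ(U, 𝒯_{X/k})`** (`X'` flat over `k[ε]`): two retractions
`σ, σ'` over an affine `V` with the same values on the constants satisfy `σ' = σ ⊕ θ` for a UNIQUE `θ ∈ Γ(i⁻¹V, 𝒯_{X/k})`
(`σ' − σ` lands in `ker i♯ = t·Γ`, `y ↦ t·σ(y)` is injective by flatness, and the quotient `D` is a `k`-derivation, `= θ ∘ d`).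
[cite: Hartshorne2010, Lemma 4.5 / Remark 10.1.1 (pp. 28, 80) and Thm. 5.3 (proof), p. 38 («`ψ_ij` … corresponds to an element `θ_ij ∈ H⁰(U_ij, 𝒯_X)`»)] -/
theorem existsUnique_tangentSheaf_section_of_retractions [Flat f] (V : X'.affineOpens)
    (σ σ' : Γ(X.left, i ⁻¹ᵁ V.1) →+* Γ(X', V.1))
    (hσ : ∀ a, i.app V.1 (σ a) = a) (hσ' : ∀ a, i.app V.1 (σ' a) = a)
    (hconst : ∀ s : k, σ' ((constToPresheaf X).app (op (i ⁻¹ᵁ V.1)) s) =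
      σ ((constToPresheaf X).app (op (i ⁻¹ᵁ V.1)) s)) :
    ∃! θ : (cotangentSheaf X).over (i ⁻¹ᵁ V.1) ⟶ (unitModule X.left).over (i ⁻¹ᵁ V.1),
      ∀ a, σ' a = σ a + sectionOn (flatSmallExtensionParam f (ε : k[ε])) V.1 *
        σ (appLE θ (𝟙 _) (dSection X (i ⁻¹ᵁ V.1) a) : Γ(X.left, i ⁻¹ᵁ V.1)) := by
  classical
  have hU : IsAffineOpen (i ⁻¹ᵁ V.1) := isAffineOpen_preimage_fibre_dualNumber f Hi V
  set t := sectionOn (flatSmallExtensionParam f (ε : k[ε])) V.1 with ht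
  have t2 : t * t = 0 := sectionOn_param_mul_self f V.1
  have tinj : ∀ y : Γ(X.left, i ⁻¹ᵁ V.1), t * σ y = 0 → y = 0 :=
    eq_zero_of_sectionOn_param_mul_retraction_eq_zero f Hi V σ hσ
  -- the difference function `D`: `σ' a - σ a = t · σ (D a)`
  have hdiff : ∀ a, ∃ y : Γ(X.left, i ⁻¹ᵁ V.1), σ' a - σ a = t * σ y := fun a => by
    obtain ⟨b, hb⟩ := exists_eq_sectionOn_param_mul f Hi V (σ' a - σ a) (by rw [map_sub, hσ, hσ', sub_self])
    exact ⟨i.app V.1 b, by rw [hb]; exact sectionOn_param_mul_eq_of_app_eq f Hi V _ _ (by rw [hσ])⟩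
  choose D hD using hdiff
  have hDuniq : ∀ a y, σ' a - σ a = t * σ y → D a = y := fun a y hy => by
    have h0 : t * σ (D a - y) = 0 := by rw [map_sub, mul_sub, ← hD, ← hy, sub_self]
    exact sub_eq_zero.mp (tinj _ h0)
  have hD' : ∀ a, σ' a = σ a + t * σ (D a) := fun a => by rw [← hD, add_sub_cancel]
  -- `D` is additive, satisfies the Leibniz rule, and kills the constants
  have hadd : ∀ a b, D (a + b) = D a + D b := fun a b =>
    hDuniq _ _ (by rw [map_add, map_add, map_add, mul_add, ← hD, ← hD]; ring)
  have hmul : ∀ a b, D (a * b) = a * D b + b * D a := fun a b =>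
    hDuniq _ _ (by
      rw [map_mul, map_mul, hD' a, hD' b, map_add, map_mul, map_mul]
      linear_combination (σ (D a) * σ (D b)) * t2)
  have hconst' : ∀ s : k, D ((constToPresheaf X).app (op (i ⁻¹ᵁ V.1)) s) = 0 := fun s =>
    hDuniq _ _ (by rw [hconst, sub_self, map_zero, mul_zero])
  -- `D = θ ∘ d` for a unique `θ`
  obtain ⟨θ, hθ, huniq⟩ := existsUnique_tangentSheaf_section_of_leibniz hU D hadd hmul hconst'
  refine ⟨θ, fun a => by rw [hθ a]; exact hD' a, fun θ₁ hθ₁ => huniq θ₁ fun a => ?_⟩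
  exact (hDuniq a _ (by rw [hθ₁ a]; ring)).symm

include Hi in
/-- If `σ' = σ ⊕ θ = σ ⊕ θ₁` over an affine open of a flat `X'`, then `θ = θ₁`. [cite: Hartshorne2010, Thm. 5.3 (proof), p. 38] -/
theorem tangentSheaf_section_eq_of_eq_add_of_eq_add [Flat f] (V : X'.affineOpens)
    {σ σ' : Γ(X.left, i ⁻¹ᵁ V.1) →+* Γ(X', V.1)} (hσ : ∀ a, i.app V.1 (σ a) = a)
    {θ θ₁ : (cotangentSheaf X).over (i ⁻¹ᵁ V.1) ⟶ (unitModule X.left).over (i ⁻¹ᵁ V.1)}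
    (hθ : ∀ a, σ' a = σ a + sectionOn (flatSmallExtensionParam f (ε : k[ε])) V.1 *
      σ (appLE θ (𝟙 _) (dSection X (i ⁻¹ᵁ V.1) a) : Γ(X.left, i ⁻¹ᵁ V.1)))
    (hθ₁ : ∀ a, σ' a = σ a + sectionOn (flatSmallExtensionParam f (ε : k[ε])) V.1 *
      σ (appLE θ₁ (𝟙 _) (dSection X (i ⁻¹ᵁ V.1) a) : Γ(X.left, i ⁻¹ᵁ V.1))) :
    θ = θ₁ := by
  have hσ' : ∀ a, i.app V.1 (σ' a) = a := app_eq_self_of_eq_add f Hi V hσ hθ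
  obtain ⟨θ₀, -, huniq⟩ := existsUnique_tangentSheaf_section_of_retractions f Hi V σ σ' hσ hσ'
    (map_constToPresheaf_eq_of_eq_add f V hθ)
  rw [huniq θ hθ, huniq θ₁ hθ₁]

/-! ### §4 Compatibility with restriction to a smaller affine open -/

include Hi in
/-- **Restriction**: for affine opens `V' ⊆ V` of the flat `X'`, `σ' = σ ⊕ θ` over `V`, and retractions `τ, τ'` over `V'`
compatible with `σ, σ'`: `τ' = τ ⊕ θ|_{i⁻¹V'}` (`θ'` over `V'` is determined on the restrictions of `Γ(i⁻¹V, 𝒪_X)`).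
[cite: Hartshorne2010, Thm. 5.3 (proof), p. 38 («on `U_ijk` we have `θ_ij + θ_jk + θ_ki = 0`», restriction of the local data)] -/
theorem eq_add_restrictHom_of_eq_add [Flat f] {V V' : X'.affineOpens} (hle : V'.1 ≤ V.1)
    {σ σ' : Γ(X.left, i ⁻¹ᵁ V.1) →+* Γ(X', V.1)} {τ τ' : Γ(X.left, i ⁻¹ᵁ V'.1) →+* Γ(X', V'.1)}
    (hτ : ∀ a, i.app V'.1 (τ a) = a) (hτ' : ∀ a, i.app V'.1 (τ' a) = a)
    (hστ : ∀ a, X'.presheaf.map (homOfLE hle).op (σ a) =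
      τ (X.left.presheaf.map (homOfLE (i.preimage_mono hle)).op a))
    (hσ'τ' : ∀ a, X'.presheaf.map (homOfLE hle).op (σ' a) =
      τ' (X.left.presheaf.map (homOfLE (i.preimage_mono hle)).op a))
    (hconstτ : ∀ s : k, τ' ((constToPresheaf X).app (op (i ⁻¹ᵁ V'.1)) s) =
      τ ((constToPresheaf X).app (op (i ⁻¹ᵁ V'.1)) s))
    {θ : (cotangentSheaf X).over (i ⁻¹ᵁ V.1) ⟶ (unitModule X.left).over (i ⁻¹ᵁ V.1)}
    (h : ∀ a, σ' a = σ a + sectionOn (flatSmallExtensionParam f (ε : k[ε])) V.1 *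
      σ (appLE θ (𝟙 _) (dSection X (i ⁻¹ᵁ V.1) a) : Γ(X.left, i ⁻¹ᵁ V.1))) (a' : Γ(X.left, i ⁻¹ᵁ V'.1)) :
    τ' a' = τ a' + sectionOn (flatSmallExtensionParam f (ε : k[ε])) V'.1 *
      τ (appLE (restrictHom (homOfLE (i.preimage_mono hle)) θ) (𝟙 _) (dSection X (i ⁻¹ᵁ V'.1) a') :
        Γ(X.left, i ⁻¹ᵁ V'.1)) := by
  have hU : IsAffineOpen (i ⁻¹ᵁ V.1) := isAffineOpen_preimage_fibre_dualNumber f Hi V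
  -- the `θ'` over `V'`
  obtain ⟨θ', hθ', -⟩ := existsUnique_tangentSheaf_section_of_retractions f Hi V' τ τ' hτ hτ' hconstτ
  -- `θ' = θ|_{U'}`: compare derivations on the restrictions of `Γ(U, 𝒪_X)`
  have key : θ' = restrictHom (homOfLE (i.preimage_mono hle)) θ := by
    refine tangentSheaf_hom_ext_of_le_isAffineOpen hU (i.preimage_mono hle) fun a => ?_
    rw [← map_appLE_dSection]
    apply eq_zero_of_sectionOn_param_mul_retraction_eq_zero f Hi V' τ hτ _ ?_ |> fun h0 => sub_eq_zero.mp h0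
    -- `t' · τ (θ'(d(a|)) − θ(da)|) = 0`
    have e1 := hθ' (X.left.presheaf.map (homOfLE (i.preimage_mono hle)).op a)
    rw [← hσ'τ', h a, map_add, map_mul, map_sectionOn, hστ, hστ, add_right_inj] at e1
    rw [map_sub, mul_sub, sub_eq_zero]
    exact e1.symm
  rw [← key]
  exact hθ' a'


/-! ### §5 Local existence of retractions (formal smoothness of the affine pieces of `X`) -/

include Hi in
/-- `i♯` maps the structure constants of `X'` to those of `X` (naturality in `Hi`). [cite: Hartshorne2010, §6 (6.1), p. 46] -/
theorem app_flatSecStructureMap_inl (V : X'.Opens) (s : k) :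
    i.app V (flatSecStructureMap f V (inl s)) = (constToPresheaf X).app (op (i ⁻¹ᵁ V)) s := by
  have h : i.app ⊤ (specStructureMap f (inl s : k[ε])) = specStructureMap X.hom ((fstHom k k k).toRingHom (inl s)) :=
    appTop_specStructureMap_of_isPullback f Hi (inl s : k[ε])
  rw [flatSecStructureMap_apply, ← CommRingCat.comp_apply, Scheme.Hom.naturality, CommRingCat.comp_apply, h]
  change X.left.presheaf.map _ (specStructureMap X.hom ((fstHom k k k) (inl s))) = _
  rw [fstHom_apply, fst_inl]
  rfl

include Hi in
/-- `ker i♯ = (t|_V)` on an affine open. [cite: Hartshorne2010, §6 proof of Thm. 6.4, p. 50] -/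
theorem ker_app_eq_span_sectionOn_param (V : X'.affineOpens) :
    RingHom.ker (i.app V.1).hom = Ideal.span {sectionOn (flatSmallExtensionParam f (ε : k[ε])) V.1} := by
  rw [ker_app_eq_map_of_isPullback (fstHom k k k).toRingHom (dualNumber_fstHom_surjective k) Hi V,
    dualNumber_ker_fstHom_eq_span, Ideal.map_span, Set.image_singleton]
  rfl

include Hi in
/-- **Local existence of retractions**: if `Γ(i⁻¹V, 𝒪_X)` is formally smooth over `k` (e.g. `X → Spec k` smooth), a
retraction over the affine `V` exists, compatible with the `k`-structures (lift `id` along `i♯`, square-zero kernel `(t|_V)`).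
[cite: Hartshorne2010, Cor. 4.8 (p. 30: deformations of a nonsingular affine scheme over `D` are trivial) and Thm. 5.3 (proof), p. 38] -/
theorem exists_retraction_of_formallySmooth (V : X'.affineOpens) [Algebra k Γ(X.left, i ⁻¹ᵁ V.1)]
    (halg : ∀ s : k, algebraMap k Γ(X.left, i ⁻¹ᵁ V.1) s = (constToPresheaf X).app (op (i ⁻¹ᵁ V.1)) s)
    [Algebra.FormallySmooth k Γ(X.left, i ⁻¹ᵁ V.1)] :
    ∃ σ : Γ(X.left, i ⁻¹ᵁ V.1) →+* Γ(X', V.1), (∀ a, i.app V.1 (σ a) = a) ∧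
      ∀ s : k, σ ((constToPresheaf X).app (op (i ⁻¹ᵁ V.1)) s) = flatSecStructureMap f V.1 (inl s) := by
  haveI := isClosedImmersion_fibre_dualNumber f Hi
  letI algV : Algebra k Γ(X', V.1) := ((flatSecStructureMap f V.1).comp (algebraMap k k[ε])).toAlgebra
  have halgV : ∀ s : k, algebraMap k Γ(X', V.1) s = flatSecStructureMap f V.1 (inl s) := fun _ => rfl
  -- `i♯` as a `k`-algebra map
  let ρ : Γ(X', V.1) →ₐ[k] Γ(X.left, i ⁻¹ᵁ V.1) :=
    { (i.app V.1).hom with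
      commutes' := fun s => by
        change i.app V.1 (algebraMap k Γ(X', V.1) s) = _
        rw [halgV, halg, app_flatSecStructureMap_inl f Hi] }
  have hρ : ∀ b, ρ b = i.app V.1 b := fun _ => rfl
  have hsurj : Function.Surjective ρ := i.app_surjective V.1 V.2
  have hnil : IsNilpotent (RingHom.ker (ρ : Γ(X', V.1) →+* Γ(X.left, i ⁻¹ᵁ V.1))) := by
    change IsNilpotent (RingHom.ker (i.app V.1).hom)
    rw [ker_app_eq_span_sectionOn_param f Hi V]
    exact ⟨2, by rw [Ideal.span_singleton_pow, pow_two, sectionOn_param_mul_self, Ideal.zero_eq_bot, Ideal.span_singleton_eq_bot]⟩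
  let σ := Algebra.FormallySmooth.liftOfSurjective (AlgHom.id k Γ(X.left, i ⁻¹ᵁ V.1)) ρ hsurj hnil
  refine ⟨σ.toRingHom, fun a => ?_, fun s => ?_⟩
  · change ρ (σ a) = a
    exact Algebra.FormallySmooth.liftOfSurjective_apply _ ρ hsurj hnil a
  · change σ _ = _
    rw [← halg, σ.commutes, halgV]

end Retractions

end Literature.AlgebraicGeometry.Deformation

end
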